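import Summits.CriticalPhenomena.Ising3DConformalLimit.Theses.UnitLightCone
import Summits.CriticalPhenomena.Ising3DConformalLimit.Theorems.HyperoctahedralRPTwoPointLimitIsotropicHolds
import HarnessLib

/-!
# Crux `UnitLightCone.LightConeRoundness` (item stmt-CriticalPhenomena-17169) — PROVED

Route `route-CriticalPhenomena-UnitLightCone` (sub `Ising3DConformalLimit`), crux rank 7:
`Summit.CriticalPhenomena.Ising3DConformalLimit.Theses.UnitLightCone.LightConeRoundness` — for every normalised,
non-degenerate, translation-invariant, scale-covariant pointwise scaling limit `S` of `criticalCorr 3`, unit-light-cone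
Källén–Lehmann representations of `x ↦ S 2 (0, x)` in the frames `e₃` and `(e₁+e₂)/√2` imply
`S 2 (0, R x) = S 2 (0, x)` for every linear isometry `R` of `ℝ³`.

## Proof (line `Sketch` / `intree-transfer`, 0 stubs)

The conclusion of the crux is, under a SUBSET of its hypotheses, the landed theorem
`Summit.CriticalPhenomena.Ising3DConformalLimit.HyperoctahedralRPTwoPoint.kernel_rotation_invariant`
(`Theorems/HyperoctahedralRPTwoPointLimitIsotropicHolds.lean`; route HyperoctahedralRP, milestone item
stmt-CriticalPhenomena-1984, closed · proved = crux `HRP2Rigidity_of` ∘ glue `twoPointKernelOfLimit_proof`): two-point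
`O(3)`-invariance of every non-degenerate, translation-invariant, scale-covariant pointwise limit of `criticalCorr 3`, at
every point. The normalisation off `NonCoincident` and the two Källén–Lehmann hypotheses of the crux are not needed.

Contents:
* `LightConeRoundness_of_twoPointLimitIsotropic` — reduction to the sibling ITEM decl
  `HyperoctahedralRP.TwoPointLimitIsotropic` (guard `x ≠ 0` discharged at `x = 0` by `R 0 = 0`);
* `LightConeRoundness_of` / `lightConeRoundness_proof` — the crux BY NAME, hypothesis-free.
-/

namespace Summit.CriticalPhenomena.Ising3DConformalLimit.Theorems.UnitLightConeLightConeRoundness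

open Summit.CriticalPhenomena.Ising3DConformalLimit.HyperoctahedralRPTwoPoint

/-- Reduction to the sibling item: HyperoctahedralRP's milestone `TwoPointLimitIsotropic`
(stmt-CriticalPhenomena-1984; isotropy of the limit two-point kernel off the origin) implies `LightConeRoundness` —
drop the normalisation and the two Källén–Lehmann hypotheses, and treat `x = 0` by `R 0 = 0`. [folklore] -/
theorem LightConeRoundness_of_twoPointLimitIsotropic
    (h : _root_.Summit.CriticalPhenomena.Ising3DConformalLimit.Theses.HyperoctahedralRP.TwoPointLimitIsotropic) :
    _root_.Summit.CriticalPhenomena.Ising3DConformalLimit.Theses.UnitLightCone.LightConeRoundness := by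
  intro ρ Δ S hρ hlim _hnorm hnd htr hsc _hax _hdg R x
  by_cases hx : x = 0
  · subst hx
    simp
  · exact h ρ Δ S hρ hlim hnd htr hsc R x hx

/-- **`LightConeRoundness_of` — the crux BY NAME, sorry-free, zero stubs**, from the landed theorem
`kernel_rotation_invariant` (two-point isotropy of the critical `ℤ³` Ising scaling limit at every point; the
normalisation and the two unit-light-cone Källén–Lehmann hypotheses are unused). [folklore] -/
theorem LightConeRoundness_of :
    _root_.Summit.CriticalPhenomena.Ising3DConformalLimit.Theses.UnitLightCone.LightConeRoundness := by
  intro ρ Δ S hρ hlim _hnorm hnd htr hsc _hax _hdg R x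
  exact kernel_rotation_invariant hρ hlim hnd htr hsc R x

/-- The crux `UnitLightCone.LightConeRoundness` (item stmt-CriticalPhenomena-17169), closing theorem: for every
normalised, non-degenerate, translation-invariant, scale-covariant pointwise scaling limit `S` of `criticalCorr 3`
(with the two unit-light-cone Källén–Lehmann representations, unused), `S 2 (0, R x) = S 2 (0, x)` for every linear
isometry `R` of `ℝ³`. [folklore] -/
theorem lightConeRoundness_proof :
    _root_.Summit.CriticalPhenomena.Ising3DConformalLimit.Theses.UnitLightCone.LightConeRoundness :=
  LightConeRoundness_of

/-- The same conclusion through the sibling item decl (the reduction composes with the landed milestone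
`twoPointLimitIsotropic_proof`). [folklore] -/
theorem lightConeRoundness_proof' :
    _root_.Summit.CriticalPhenomena.Ising3DConformalLimit.Theses.UnitLightCone.LightConeRoundness :=
  LightConeRoundness_of_twoPointLimitIsotropic twoPointLimitIsotropic_proof

end Summit.CriticalPhenomena.Ising3DConformalLimit.Theorems.UnitLightConeLightConeRoundness
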